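import Literature.MathematicalPhysics.KineticTheory.HardSphereGainExchangePrep
import HarnessLib

/-!
# The exchange symmetry of the three-dimensional hard-sphere gain term, II: the polar axis

For the unit sphere `S² ⊆ ℝ³ = EuclideanSpace ℝ (Fin 3)` with its surface measure
`σ = volume.toSphere` (`KineticTheory.sphereMeasure`) and the axis `e = e₂`, we prove

`∫_{S²} (ω·e)₊ G((ω·e) ω) dσ(ω) = ∫_{S²} (ω·e)₊ G(e - (ω·e) ω) dσ(ω)`
(`lintegral_sphere_gain_exchange_axis`)

for every measurable `G ≥ 0` on `ℝ³`. With `V = |V| e` the two arguments are (up to the factor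
`|V|`) the velocity transfers `(V·ω) ω` and `V - (V·ω) ω` of a hard-sphere collision with relative
velocity `V`, i.e. `v_*' - v_*` and `v' - v_*`: both are distributed alike under `(V·ω)₊ dω`, which
is special to dimension `3` (isotropy of the hard-sphere cross-section in the `σ`-representation),
and which makes the two gain terms `∫∫ B M_* g(v')` and `∫∫ B M_* g(v_*')` of the linearised
hard-sphere operator coincide pointwise. Proof: both sides equal `∫ H` for
`H(y) = 1_{y·e > 0} (ŷ·e) G((ŷ·e) ŷ) ρ(|y|)`, `ρ(r) = 1_{r > 1} r⁻⁴`, computed in polar coordinates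
(`KineticTheory.lintegral_eq_lintegral_sphereMeasure_polar`) once directly and once after the
quadratic substitution `Q(x) = |P x|² e - (x·e) P x` of `HardSphereGainExchangePrep`
(`lintegral_halfSpace_eq_quadraticSwap_euclidean`), which maps the ray `r ω` to the ray
`r² (e - (ω·e) ω)`; the pole `ω = e` is `σ`-null (`sphereMeasure_singleton`).

The rotation to a general relative velocity and the application to the gain term follow in
`HardSphereGainExchange.lean`. No new definitions are introduced.
-/

open MeasureTheory Metric Set Filter Real
open scoped ENNReal InnerProductSpace Pointwise

namespace Literature.MathematicalPhysics.KineticTheory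

noncomputable section

/-! ### Vector identities on the unit sphere of `ℝ³` around the axis -/

section Vectors

variable {F : Type*} [NormedAddCommGroup F] [InnerProductSpace ℝ F]

/-- For unit vectors `ω, e` with `c = ⟪ω, e⟫`: `|ω - c e|² = 1 - c²`. [folklore] -/
theorem norm_sq_sub_inner_smul_unit {ω e : F} (hω : ‖ω‖ = 1) (he : ‖e‖ = 1) :
    ‖ω - ⟪ω, e⟫_ℝ • e‖ ^ 2 = 1 - ⟪ω, e⟫_ℝ ^ 2 := by
  rw [norm_sub_sq_real, norm_smul, hω, he, Real.norm_eq_abs, mul_one, sq_abs, real_inner_smul_right]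
  ring

/-- For unit vectors `ω, e` with `c = ⟪ω, e⟫`: `|e - c ω|² = 1 - c²`. [folklore] -/
theorem norm_sq_unit_sub_inner_smul {ω e : F} (hω : ‖ω‖ = 1) (he : ‖e‖ = 1) :
    ‖e - ⟪ω, e⟫_ℝ • ω‖ ^ 2 = 1 - ⟪ω, e⟫_ℝ ^ 2 := by
  rw [norm_sub_sq_real, norm_smul, hω, he, Real.norm_eq_abs, mul_one, sq_abs, real_inner_smul_right,
    real_inner_comm]
  ring

/-- The quadratic map on a unit vector: `|ω - c e|² e - c (ω - c e) = e - c ω`, `c = ⟪ω, e⟫`.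
[folklore] -/
theorem quadraticSwap_unit {ω e : F} (hω : ‖ω‖ = 1) (he : ‖e‖ = 1) :
    ‖ω - ⟪ω, e⟫_ℝ • e‖ ^ 2 • e - ⟪ω, e⟫_ℝ • (ω - ⟪ω, e⟫_ℝ • e) = e - ⟪ω, e⟫_ℝ • ω := by
  rw [norm_sq_sub_inner_smul_unit hω he]
  module

/-- Homogeneity of the quadratic map: `Q(r ω) = r² Q(ω)`. [folklore] -/
theorem quadraticSwap_smul (r : ℝ) (ω e : F) :
    ‖r • ω - ⟪r • ω, e⟫_ℝ • e‖ ^ 2 • e - ⟪r • ω, e⟫_ℝ • (r • ω - ⟪r • ω, e⟫_ℝ • e) =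
      r ^ 2 • (‖ω - ⟪ω, e⟫_ℝ • e‖ ^ 2 • e - ⟪ω, e⟫_ℝ • (ω - ⟪ω, e⟫_ℝ • e)) := by
  have h1 : r • ω - ⟪r • ω, e⟫_ℝ • e = r • (ω - ⟪ω, e⟫_ℝ • e) := by
    rw [real_inner_smul_left, smul_sub, smul_smul]
  rw [h1, norm_smul, mul_pow, Real.norm_eq_abs, sq_abs, real_inner_smul_left]
  module

end Vectors

/-! ### The exchange identity around the axis -/

/-- **Exchange symmetry of the hard-sphere gain term in `ℝ³`, axis version.** For every measurable
`G ≥ 0` on `ℝ³ = EuclideanSpace ℝ (Fin 3)` and `e = e₂`,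
`∫_{S²} (ω·e)₊ G((ω·e) ω) dσ = ∫_{S²} (ω·e)₊ G(e - (ω·e) ω) dσ`: the impact direction `ω` and the
direction of `e - (ω·e) ω` carry the same measure `(ω·e)₊ dσ(ω)` (in `d = 3` only). Both sides are
`∫ H` for `H(y) = 1_{y·e > 0} (ŷ·e) G((ŷ·e) ŷ) ρ(|y|)`, `ρ(r) = 1_{r>1} r⁻⁴`, computed in polar
coordinates before and after the quadratic substitution
`lintegral_halfSpace_eq_quadraticSwap_euclidean`. [folklore] -/
theorem lintegral_sphere_gain_exchange_axis {G : EuclideanSpace ℝ (Fin 3) → ℝ≥0∞} (hG : Measurable G) :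
    ∫⁻ ω : sphere (0 : EuclideanSpace ℝ (Fin 3)) 1,
        ENNReal.ofReal (max ⟪(ω : EuclideanSpace ℝ (Fin 3)), EuclideanSpace.single 2 (1 : ℝ)⟫_ℝ 0) *
          G (⟪(ω : EuclideanSpace ℝ (Fin 3)), EuclideanSpace.single 2 (1 : ℝ)⟫_ℝ •
            (ω : EuclideanSpace ℝ (Fin 3))) ∂sphereMeasure =
      ∫⁻ ω : sphere (0 : EuclideanSpace ℝ (Fin 3)) 1,
        ENNReal.ofReal (max ⟪(ω : EuclideanSpace ℝ (Fin 3)), EuclideanSpace.single 2 (1 : ℝ)⟫_ℝ 0) *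
          G (EuclideanSpace.single 2 (1 : ℝ) -
            ⟪(ω : EuclideanSpace ℝ (Fin 3)), EuclideanSpace.single 2 (1 : ℝ)⟫_ℝ •
              (ω : EuclideanSpace ℝ (Fin 3))) ∂sphereMeasure := by
  set e : EuclideanSpace ℝ (Fin 3) := EuclideanSpace.single 2 (1 : ℝ) with he_def
  have he : ‖e‖ = 1 := by simp [he_def]
  have hn : Module.finrank ℝ (EuclideanSpace ℝ (Fin 3)) = 2 + 1 := by simp
  have hE2 : 2 ≤ Module.finrank ℝ (EuclideanSpace ℝ (Fin 3)) := by simp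
  have hS : MeasurableSet {y : EuclideanSpace ℝ (Fin 3) | 0 < ⟪y, e⟫_ℝ} :=
    measurableSet_halfSpace_single_two
  -- the radial profile and the integrand `H₀`
  set ρ : ℝ → ℝ≥0∞ := {t : ℝ | 1 < t}.indicator fun t => ENNReal.ofReal ((t ^ 4)⁻¹) with hρ
  have hρm : Measurable ρ :=
    ((measurable_id'.pow_const 4).inv.ennreal_ofReal).indicator (measurableSet_lt measurable_const measurable_id')
  set H₀ : EuclideanSpace ℝ (Fin 3) → ℝ≥0∞ := fun y =>
    ENNReal.ofReal ⟪‖y‖⁻¹ • y, e⟫_ℝ * G (⟪‖y‖⁻¹ • y, e⟫_ℝ • (‖y‖⁻¹ • y)) * ρ ‖y‖ with hH₀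
  have hunitm : Measurable fun y : EuclideanSpace ℝ (Fin 3) => ‖y‖⁻¹ • y :=
    measurable_norm.inv.smul measurable_id
  have hinm : Measurable fun y : EuclideanSpace ℝ (Fin 3) => ⟪‖y‖⁻¹ • y, e⟫_ℝ :=
    (continuous_id.inner continuous_const).measurable.comp hunitm
  have hH₀m : Measurable H₀ :=
    (hinm.ennreal_ofReal.mul (hG.comp (hinm.smul hunitm))).mul (hρm.comp measurable_norm)
  -- Step L: `∫ H = ` the left-hand side
  have hL : ∫⁻ y, {y : EuclideanSpace ℝ (Fin 3) | 0 < ⟪y, e⟫_ℝ}.indicator H₀ y =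
      ∫⁻ ω : sphere (0 : EuclideanSpace ℝ (Fin 3)) 1,
        ENNReal.ofReal (max ⟪(ω : EuclideanSpace ℝ (Fin 3)), e⟫_ℝ 0) *
          G (⟪(ω : EuclideanSpace ℝ (Fin 3)), e⟫_ℝ • (ω : EuclideanSpace ℝ (Fin 3))) ∂sphereMeasure := by
    rw [lintegral_eq_lintegral_sphereMeasure_polar hn (hH₀m.indicator hS)]
    refine lintegral_congr fun ω => ?_
    have hω : ‖(ω : EuclideanSpace ℝ (Fin 3))‖ = 1 := norm_eq_of_mem_sphere ω
    have key : ∀ r ∈ Ioi (0 : ℝ), ENNReal.ofReal (r ^ 2) *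
        {y : EuclideanSpace ℝ (Fin 3) | 0 < ⟪y, e⟫_ℝ}.indicator H₀ (r • (ω : EuclideanSpace ℝ (Fin 3))) =
        (ENNReal.ofReal (max ⟪(ω : EuclideanSpace ℝ (Fin 3)), e⟫_ℝ 0) *
          G (⟪(ω : EuclideanSpace ℝ (Fin 3)), e⟫_ℝ • (ω : EuclideanSpace ℝ (Fin 3)))) *
          (ENNReal.ofReal (r ^ 2) * ρ r) := by
      intro r hr
      have hr : 0 < r := hr
      have hnorm : ‖r • (ω : EuclideanSpace ℝ (Fin 3))‖ = r := by
        rw [norm_smul, Real.norm_of_nonneg hr.le, hω, mul_one]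
      have hunit : ‖r • (ω : EuclideanSpace ℝ (Fin 3))‖⁻¹ • (r • (ω : EuclideanSpace ℝ (Fin 3))) = ω := by
        rw [hnorm, smul_smul, inv_mul_cancel₀ hr.ne', one_smul]
      have hinner : ⟪r • (ω : EuclideanSpace ℝ (Fin 3)), e⟫_ℝ = r * ⟪(ω : EuclideanSpace ℝ (Fin 3)), e⟫_ℝ :=
        real_inner_smul_left _ _ _
      by_cases hc : 0 < ⟪(ω : EuclideanSpace ℝ (Fin 3)), e⟫_ℝ
      · have hmem : r • (ω : EuclideanSpace ℝ (Fin 3)) ∈ {y : EuclideanSpace ℝ (Fin 3) | 0 < ⟪y, e⟫_ℝ} := by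
          show 0 < ⟪r • (ω : EuclideanSpace ℝ (Fin 3)), e⟫_ℝ
          rw [hinner]; positivity
        rw [indicator_of_mem hmem]
        simp only [hH₀]
        rw [hunit, hnorm, max_eq_left hc.le]
        ring
      · have hnmem : r • (ω : EuclideanSpace ℝ (Fin 3)) ∉ {y : EuclideanSpace ℝ (Fin 3) | 0 < ⟪y, e⟫_ℝ} := by
          show ¬ 0 < ⟪r • (ω : EuclideanSpace ℝ (Fin 3)), e⟫_ℝ
          rw [hinner]
          exact not_lt.2 (mul_nonpos_of_nonneg_of_nonpos hr.le (not_lt.1 hc))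
        rw [indicator_of_notMem hnmem, max_eq_right (not_lt.1 hc), ENNReal.ofReal_zero]
        simp
    rw [setLIntegral_congr_fun measurableSet_Ioi key,
      lintegral_const_mul _ (show Measurable (fun r : ℝ => ENNReal.ofReal (r ^ 2) * ρ r) from
        ((measurable_id'.pow_const 2).ennreal_ofReal).mul hρm),
      lintegral_radial_weight, mul_one]
  -- Step R: `∫ H = ` the right-hand side
  have hR : ∫⁻ y, {y : EuclideanSpace ℝ (Fin 3) | 0 < ⟪y, e⟫_ℝ}.indicator H₀ y =
      ∫⁻ ω : sphere (0 : EuclideanSpace ℝ (Fin 3)) 1,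
        ENNReal.ofReal (max ⟪(ω : EuclideanSpace ℝ (Fin 3)), e⟫_ℝ 0) *
          G (e - ⟪(ω : EuclideanSpace ℝ (Fin 3)), e⟫_ℝ • (ω : EuclideanSpace ℝ (Fin 3))) ∂sphereMeasure := by
    rw [lintegral_halfSpace_eq_quadraticSwap_euclidean hH₀m]
    have hcont : Continuous fun x : EuclideanSpace ℝ (Fin 3) => 2 * ⟪x, e⟫_ℝ * ‖x - ⟪x, e⟫_ℝ • e‖ ^ 2 := by
      fun_prop
    have hIm : Measurable fun x : EuclideanSpace ℝ (Fin 3) =>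
        {x : EuclideanSpace ℝ (Fin 3) | 0 < ⟪x, e⟫_ℝ}.indicator (fun x =>
          ENNReal.ofReal (2 * ⟪x, e⟫_ℝ * ‖x - ⟪x, e⟫_ℝ • e‖ ^ 2) *
            H₀ (‖x - ⟪x, e⟫_ℝ • e‖ ^ 2 • e - ⟪x, e⟫_ℝ • (x - ⟪x, e⟫_ℝ • e))) x :=
      (hcont.measurable.ennreal_ofReal.mul
        (hH₀m.comp continuous_quadraticSwap_euclidean.measurable)).indicator hS
    rw [lintegral_eq_lintegral_sphereMeasure_polar hn hIm]
    -- pointwise in `ω`, off the pole `ω = e`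
    refine lintegral_congr_ae ?_
    have hnull := sphereMeasure_singleton hE2 (⟨e, mem_sphere_zero_iff_norm.2 he⟩ :
      sphere (0 : EuclideanSpace ℝ (Fin 3)) 1)
    rw [Filter.EventuallyEq, ae_iff]
    refine measure_mono_null (fun ω hω => ?_) hnull
    rw [mem_singleton_iff]
    by_contra hne
    apply hω
    have hω : ‖(ω : EuclideanSpace ℝ (Fin 3))‖ = 1 := norm_eq_of_mem_sphere ω
    set c : ℝ := ⟪(ω : EuclideanSpace ℝ (Fin 3)), e⟫_ℝ with hc_def
    by_cases hc : 0 < c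
    · -- the generic case `c > 0`, `ω ≠ e`
      set s : ℝ := ‖(ω : EuclideanSpace ℝ (Fin 3)) - c • e‖ with hs_def
      have hs2 : s ^ 2 = 1 - c ^ 2 := norm_sq_sub_inner_smul_unit hω he
      have hs0 : 0 < s := by
        refine lt_of_le_of_ne (norm_nonneg _) (fun h0 => hne ?_)
        have h0' : (ω : EuclideanSpace ℝ (Fin 3)) = c • e := by
          rw [← sub_eq_zero, ← norm_eq_zero]; exact h0.symm
        have hcc : (c - 1) * (c + 1) = 0 := by nlinarith [hs2, h0]
        have hc1 : c = 1 := by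
          rcases mul_eq_zero.1 hcc with h | h
          · linarith
          · linarith
        apply Subtype.ext
        change (ω : EuclideanSpace ℝ (Fin 3)) = e
        rw [h0', hc1, one_smul]
      have hQω : ‖(ω : EuclideanSpace ℝ (Fin 3)) - c • e‖ ^ 2 • e -
          c • ((ω : EuclideanSpace ℝ (Fin 3)) - c • e) = e - c • (ω : EuclideanSpace ℝ (Fin 3)) :=
        quadraticSwap_unit hω he
      have hQnorm : ‖e - c • (ω : EuclideanSpace ℝ (Fin 3))‖ = s := by
        have h1 : ‖e - c • (ω : EuclideanSpace ℝ (Fin 3))‖ ^ 2 = s ^ 2 := by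
          rw [hs2]; exact norm_sq_unit_sub_inner_smul hω he
        exact (pow_left_inj₀ (norm_nonneg _) hs0.le two_ne_zero).1 h1
      have hee : ⟪e, e⟫_ℝ = 1 := by rw [real_inner_self_eq_norm_sq, he, one_pow]
      -- the pointwise computation along the ray `r ω`
      have key : ∀ r ∈ Ioi (0 : ℝ), ENNReal.ofReal (r ^ 2) *
          {x : EuclideanSpace ℝ (Fin 3) | 0 < ⟪x, e⟫_ℝ}.indicator (fun x =>
            ENNReal.ofReal (2 * ⟪x, e⟫_ℝ * ‖x - ⟪x, e⟫_ℝ • e‖ ^ 2) *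
              H₀ (‖x - ⟪x, e⟫_ℝ • e‖ ^ 2 • e - ⟪x, e⟫_ℝ • (x - ⟪x, e⟫_ℝ • e)))
            (r • (ω : EuclideanSpace ℝ (Fin 3))) =
          (ENNReal.ofReal (max c 0) * G (e - c • (ω : EuclideanSpace ℝ (Fin 3))) *
            ENNReal.ofReal (2 * s ^ 3)) * (ENNReal.ofReal (r ^ 5) * ρ (r ^ 2 * s)) := by
        intro r hr
        have hr : 0 < r := hr
        have hin : ⟪r • (ω : EuclideanSpace ℝ (Fin 3)), e⟫_ℝ = r * c := real_inner_smul_left _ _ _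
        have hmem : r • (ω : EuclideanSpace ℝ (Fin 3)) ∈ {y : EuclideanSpace ℝ (Fin 3) | 0 < ⟪y, e⟫_ℝ} := by
          change 0 < ⟪r • (ω : EuclideanSpace ℝ (Fin 3)), e⟫_ℝ
          rw [hin]; positivity
        have hP : r • (ω : EuclideanSpace ℝ (Fin 3)) - ⟪r • (ω : EuclideanSpace ℝ (Fin 3)), e⟫_ℝ • e =
            r • ((ω : EuclideanSpace ℝ (Fin 3)) - c • e) := by
          rw [hin, smul_sub, smul_smul]
        have hPn : ‖r • (ω : EuclideanSpace ℝ (Fin 3)) - ⟪r • (ω : EuclideanSpace ℝ (Fin 3)), e⟫_ℝ • e‖ ^ 2 =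
            r ^ 2 * s ^ 2 := by
          rw [hP, norm_smul, Real.norm_of_nonneg hr.le, mul_pow]
        have hQ : ‖r • (ω : EuclideanSpace ℝ (Fin 3)) - ⟪r • (ω : EuclideanSpace ℝ (Fin 3)), e⟫_ℝ • e‖ ^ 2 • e -
            ⟪r • (ω : EuclideanSpace ℝ (Fin 3)), e⟫_ℝ •
              (r • (ω : EuclideanSpace ℝ (Fin 3)) - ⟪r • (ω : EuclideanSpace ℝ (Fin 3)), e⟫_ℝ • e) =
            (r ^ 2) • (e - c • (ω : EuclideanSpace ℝ (Fin 3))) := by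
          rw [← hQω]; exact quadraticSwap_smul r _ e
        have hn2 : ‖(r ^ 2) • (e - c • (ω : EuclideanSpace ℝ (Fin 3)))‖ = r ^ 2 * s := by
          rw [norm_smul, Real.norm_of_nonneg (sq_nonneg r), hQnorm]
        have hu2 : ‖(r ^ 2) • (e - c • (ω : EuclideanSpace ℝ (Fin 3)))‖⁻¹ •
            ((r ^ 2) • (e - c • (ω : EuclideanSpace ℝ (Fin 3)))) = s⁻¹ • (e - c • (ω : EuclideanSpace ℝ (Fin 3))) := by
          rw [hn2, smul_smul]
          congr 1
          field_simp
        have hin2 : ⟪s⁻¹ • (e - c • (ω : EuclideanSpace ℝ (Fin 3))), e⟫_ℝ = s := by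
          rw [real_inner_smul_left, inner_sub_left, real_inner_smul_left, hee]
          have : 1 - c * c = s ^ 2 := by rw [hs2]; ring
          rw [this]
          field_simp
        have hsm2 : ⟪s⁻¹ • (e - c • (ω : EuclideanSpace ℝ (Fin 3))), e⟫_ℝ •
            (s⁻¹ • (e - c • (ω : EuclideanSpace ℝ (Fin 3)))) = e - c • (ω : EuclideanSpace ℝ (Fin 3)) := by
          rw [hin2, smul_smul, mul_inv_cancel₀ hs0.ne', one_smul]
        rw [indicator_of_mem hmem]
        simp only [hH₀]
        rw [hQ, hu2, hsm2, hin2, hn2, hPn, hin, max_eq_left hc.le]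
        have hreal : ENNReal.ofReal (r ^ 2) * ENNReal.ofReal (2 * (r * c) * (r ^ 2 * s ^ 2)) *
            ENNReal.ofReal s = ENNReal.ofReal c * ENNReal.ofReal (2 * s ^ 3) * ENNReal.ofReal (r ^ 5) := by
          rw [← ENNReal.ofReal_mul (by positivity), ← ENNReal.ofReal_mul (by positivity),
            ← ENNReal.ofReal_mul (by positivity), ← ENNReal.ofReal_mul (by positivity)]
          congr 1
          ring
        calc ENNReal.ofReal (r ^ 2) * (ENNReal.ofReal (2 * (r * c) * (r ^ 2 * s ^ 2)) *
              (ENNReal.ofReal s * G (e - c • (ω : EuclideanSpace ℝ (Fin 3))) * ρ (r ^ 2 * s)))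
            = (ENNReal.ofReal (r ^ 2) * ENNReal.ofReal (2 * (r * c) * (r ^ 2 * s ^ 2)) * ENNReal.ofReal s) *
                (G (e - c • (ω : EuclideanSpace ℝ (Fin 3))) * ρ (r ^ 2 * s)) := by ring
          _ = (ENNReal.ofReal c * ENNReal.ofReal (2 * s ^ 3) * ENNReal.ofReal (r ^ 5)) *
                (G (e - c • (ω : EuclideanSpace ℝ (Fin 3))) * ρ (r ^ 2 * s)) := by rw [hreal]
          _ = _ := by ring
      rw [setLIntegral_congr_fun measurableSet_Ioi key,
        lintegral_const_mul _ (show Measurable (fun r : ℝ => ENNReal.ofReal (r ^ 5) * ρ (r ^ 2 * s)) from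
          ((measurable_id'.pow_const 5).ennreal_ofReal).mul
            (hρm.comp ((measurable_id'.pow_const 2).mul_const s))),
        lintegral_radial_weight_sq hs0, mul_assoc, ← ENNReal.ofReal_mul (by positivity),
        show 2 * s ^ 3 * ((s ^ 3)⁻¹ / 2) = 1 by field_simp, ENNReal.ofReal_one, mul_one]
    · -- `c ≤ 0`: both sides vanish
      have hzero : ∀ r ∈ Ioi (0 : ℝ), ENNReal.ofReal (r ^ 2) *
          {x : EuclideanSpace ℝ (Fin 3) | 0 < ⟪x, e⟫_ℝ}.indicator (fun x =>
            ENNReal.ofReal (2 * ⟪x, e⟫_ℝ * ‖x - ⟪x, e⟫_ℝ • e‖ ^ 2) *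
              H₀ (‖x - ⟪x, e⟫_ℝ • e‖ ^ 2 • e - ⟪x, e⟫_ℝ • (x - ⟪x, e⟫_ℝ • e)))
            (r • (ω : EuclideanSpace ℝ (Fin 3))) = 0 := by
        intro r hr
        have hr : 0 < r := hr
        have hnmem : r • (ω : EuclideanSpace ℝ (Fin 3)) ∉ {y : EuclideanSpace ℝ (Fin 3) | 0 < ⟪y, e⟫_ℝ} := by
          show ¬ 0 < ⟪r • (ω : EuclideanSpace ℝ (Fin 3)), e⟫_ℝ
          rw [real_inner_smul_left]
          exact not_lt.2 (mul_nonpos_of_nonneg_of_nonpos hr.le (not_lt.1 hc))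
        rw [indicator_of_notMem hnmem, mul_zero]
      rw [setLIntegral_congr_fun measurableSet_Ioi hzero, lintegral_zero, max_eq_right (not_lt.1 hc),
        ENNReal.ofReal_zero, zero_mul]
  rw [← hL, hR]

end

end Literature.MathematicalPhysics.KineticTheory
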